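import Summits.BirchSwinnertonDyer.BirchSwinnertonDyer.Theorems.ResidualThetaTransportAtTwoThetaLayerLambdaCongruenceAtTwoCosetWalkLift
import Summits.BirchSwinnertonDyer.BirchSwinnertonDyer.Theorems.ResidualThetaTransportAtTwoThetaLayerLambdaCongruenceAtTwoDualChainParabolic
import HarnessLib

/-!
# Crux `ThetaLayerLambdaCongruenceAtTwo` (stmt-BirchSwinnertonDyer-20688, route ResidualThetaTransportAtTwo), line
# `birth` v13 — SD floor, brick S4 (part 6b): every INTEGRAL MANIN SYSTEM is the crossing vector of a dual chain of an element of
# `Γ₀(N)` — `Γ₀(N) → H₁(Γ₀(N)\tree; ℤ)` is onto (flow decomposition + lifting) (width seat bsd-wall-rtt-p3-w2 g8;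
# `--supports stmt-BirchSwinnertonDyer-20688 --as helper`; closes nothing)

HONEST FRAMING. Elementary THEOREMS on functions `SL₂(ℤ)/Γ₀(N) → ℤ` and lists of matrices; no definition; nothing about any curve or
form is asserted; BSD is not proved by any of this.

WHAT (`exists_dualChain_of_maninSystem`). Let `N ≥ 1` and `M : Gamma0Coset N → ℤ` with (i) `M(S·q) = −M(q)` and (ii)
`M(q) + M(TS·q) + M((TS)²·q) = 0` (an integral `1`-cycle of the quotient of the dual Farey tree by `Γ₀(N)`). Then there are `γ ∈ Γ₀(N)`
and a dual chain `D` of `γ` (`…DualChain`) with `vec(D) = M`. Proof: if `M ≠ 0`, follow the flow — from an oriented edge `x` with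
`M(x) > 0` the relation (ii) at the triangle entered provides an outgoing edge with `M > 0`; the first repetition of this walk is a
closed coset walk along edges with `M ≥ 1`, which lifts to a dual chain `D₁` of some `γ₁` (`…CosetWalkLift`); `M − vec(D₁)` is again a
system with strictly smaller `Σ|M|`; induct and multiply the `γ`'s (`dualChainVec_mul`). Consequence (next file): the crossing pairing
of `…CrossingPairing` is PERFECT.

References: J.-P. Serre, Trees, §I.5 (`H₁` of a quotient graph); [Manin1972] §1.5–1.7.
-/

set_option autoImplicit false

noncomputable section

-- justification: the `Summit.BirchSwinnertonDyer.BirchSwinnertonDyer.…` path repeats a component (route-file convention)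
set_option linter.dupNamespace false

open scoped Classical MatrixGroups

open CongruenceSubgroup Matrix.SpecialLinearGroup ModularGroup
open Literature.NumberTheory.EllipticCurves.ModularForms

namespace Summit.BirchSwinnertonDyer.BirchSwinnertonDyer.Theorems.ThetaLayerLambdaCongruenceAtTwo

section Flow

variable {N : ℕ} [NeZero N]

omit [NeZero N] in
/-- `(hτʲ)⁻¹Γ₀(N) = (TS)ʲ·(h⁻¹Γ₀(N))` (`τ⁻¹ = −TS` and `−1` acts trivially). [folklore] -/
theorem coe_mul_tau_pow_inv (h : SL(2, ℤ)) (j : ℕ) :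
    (((h * (S * T⁻¹) ^ j)⁻¹ : SL(2, ℤ)) : Gamma0Coset N) = (T * S) ^ j • ((h⁻¹ : SL(2, ℤ)) : Gamma0Coset N) := by
  induction j with
  | zero => rw [pow_zero, pow_zero, mul_one, one_smul]
  | succ j ih =>
    rw [pow_succ, ← mul_assoc, coe_mul_inv_eq_smul, ih, mul_inv_rev, inv_inv, S_inv_eq_neg_S, mul_neg, neg_smul_coset,
      ← mul_smul, ← pow_succ']

/-- **Every integral Manin system is the crossing vector of a dual chain of some `γ ∈ Γ₀(N)`** (surjectivity of
`Γ₀(N) → H₁(Γ₀(N)\tree; ℤ)`; flow decomposition + `…CosetWalkLift`). [cite: Manin1972, §1.5] -/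
theorem exists_dualChain_of_maninSystem (M : Gamma0Coset N → ℤ) (hM1 : ∀ q, M (S • q) = -M q)
    (hM2 : ∀ q, M q + M ((T * S) • q) + M ((T * S) • (T * S) • q) = 0) :
    ∃ (γ : Gamma0 N) (D : List SL(2, ℤ)),
      (∀ {A : Type} [AddCommGroup A] (G : SL(2, ℤ) → A), (∀ x, G (x * (S * T⁻¹)) = G x) → (∀ x, G (-x) = G x) →
        (D.map fun g ↦ G g - G (g * S)).sum = G (γ : SL(2, ℤ)) - G 1) ∧
      (∀ q : Gamma0Coset N,
        (D.map fun g ↦ (Pi.single ((g⁻¹ : SL(2, ℤ)) : Gamma0Coset N) (1 : ℤ) -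
          Pi.single (((g * S)⁻¹ : SL(2, ℤ)) : Gamma0Coset N) 1 : Gamma0Coset N → ℤ)).sum q = M q) := by
  -- induction on `Φ(M) = Σ_q |M q|`
  suffices H : ∀ (n : ℕ) (M : Gamma0Coset N → ℤ), (∑ q, (M q).natAbs) = n → (∀ q, M (S • q) = -M q) →
      (∀ q, M q + M ((T * S) • q) + M ((T * S) • (T * S) • q) = 0) →
      ∃ (γ : Gamma0 N) (D : List SL(2, ℤ)),
        (∀ {A : Type} [AddCommGroup A] (G : SL(2, ℤ) → A), (∀ x, G (x * (S * T⁻¹)) = G x) → (∀ x, G (-x) = G x) →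
          (D.map fun g ↦ G g - G (g * S)).sum = G (γ : SL(2, ℤ)) - G 1) ∧
        (∀ q : Gamma0Coset N,
          (D.map fun g ↦ (Pi.single ((g⁻¹ : SL(2, ℤ)) : Gamma0Coset N) (1 : ℤ) -
            Pi.single (((g * S)⁻¹ : SL(2, ℤ)) : Gamma0Coset N) 1 : Gamma0Coset N → ℤ)).sum q = M q) from
    H _ M rfl hM1 hM2
  intro n
  induction n using Nat.strong_induction_on with
  | _ n ih =>
    intro M hn hM1 hM2
    by_cases hzero : ∀ q, M q = 0
    · -- `M = 0`: the empty chain of `1`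
      exact ⟨1, [], fun G _ _ ↦ by simp, fun q ↦ by simp [hzero q]⟩
    · simp only [not_forall] at hzero
      obtain ⟨q₁, hq₁⟩ := hzero
      -- an oriented edge with `M > 0`
      obtain ⟨x₀, hx₀⟩ : ∃ x₀, 0 < M x₀ := by
        rcases lt_or_gt_of_ne hq₁ with h | h
        · exact ⟨S • q₁, by rw [hM1]; omega⟩
        · exact ⟨q₁, h⟩
      -- the flow successor
      let next : Gamma0Coset N → Gamma0Coset N := fun x ↦
        if M ((T * S) • x) < 0 then S • (T * S) • x else S • (T * S) • (T * S) • x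
      have hnext_pos : ∀ x, 0 < M x → 0 < M (next x) := by
        intro x hx
        by_cases h : M ((T * S) • x) < 0
        · simp only [next, if_pos h, hM1]; omega
        · simp only [next, if_neg h, hM1]; have := hM2 x; omega
      have hnext_adj : ∀ x, ∃ j : ℕ, S • next x = (T * S) ^ j • x := by
        intro x
        by_cases h : M ((T * S) • x) < 0
        · refine ⟨1, ?_⟩
          simp only [next, if_pos h]
          rw [← mul_smul, S_mul_S_eq_neg_one, neg_one_smul_coset, pow_one]
        · refine ⟨2, ?_⟩
          simp only [next, if_neg h]
          rw [← mul_smul S S, S_mul_S_eq_neg_one, neg_one_smul_coset, pow_two, ← mul_smul]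
      -- the walk
      let x : ℕ → Gamma0Coset N := fun k ↦ next^[k] x₀
      have hx_succ : ∀ k, x (k + 1) = next (x k) := fun k ↦ Function.iterate_succ_apply' next k x₀
      have hx_pos : ∀ k, 0 < M (x k) := by
        intro k
        induction k with
        | zero => exact hx₀
        | succ k ihk => rw [hx_succ]; exact hnext_pos _ ihk
      -- representatives and the coset-walk condition
      let h : ℕ → SL(2, ℤ) := fun k ↦ ((x k).out)⁻¹
      have hc : ∀ k, (((h k)⁻¹ : SL(2, ℤ)) : Gamma0Coset N) = x k := fun k ↦ by
        show (((((x k).out)⁻¹)⁻¹ : SL(2, ℤ)) : Gamma0Coset N) = x k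
        rw [inv_inv]; exact QuotientGroup.out_eq' (x k)
      have hconn : ∀ k, ∃ j : ℕ, (((h (k + 1) * S)⁻¹ : SL(2, ℤ)) : Gamma0Coset N) =
          (((h k * (S * T⁻¹) ^ j)⁻¹ : SL(2, ℤ)) : Gamma0Coset N) := by
        intro k
        obtain ⟨j, hj⟩ := hnext_adj (x k)
        exact ⟨j, by rw [coe_mul_S_inv, coe_mul_tau_pow_inv, hc, hc, hx_succ, hj]⟩
      -- first repetition
      have hrep : ∃ b, ∃ a, a < b ∧ x a = x b := by
        obtain ⟨a, b, hab, he⟩ := Finite.exists_ne_map_eq_of_infinite x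
        rcases lt_or_gt_of_ne hab with hlt | hlt
        · exact ⟨b, a, hlt, he⟩
        · exact ⟨a, b, hlt, he.symm⟩
      let b := Nat.find hrep
      obtain ⟨a, hab, hxab⟩ : ∃ a, a < b ∧ x a = x b := Nat.find_spec hrep
      have hmin : ∀ b' < b, ¬ ∃ a', a' < b' ∧ x a' = x b' := fun b' hb' ↦ Nat.find_min hrep hb'
      have hdist : ∀ i i', i < b → i' < b → x i = x i' → i = i' := by
        intro i i' hi hi' he
        by_contra hne
        rcases lt_or_gt_of_ne hne with hlt | hlt
        · exact hmin i' hi' ⟨i, hlt, he⟩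
        · exact hmin i hi ⟨i', hlt, he.symm⟩
      -- the closed segment `[h a, …, h (b-1)]` and its lift
      obtain ⟨γ₁, D₁, hD₁, hvec₁⟩ := exists_dualChain_of_closed_cosetWalk (N := N) h hconn a (b - a)
        (by rw [Nat.add_sub_cancel' hab.le, hc, hc, hxab])
      -- the vector of the segment: `v q = [q visited] - [S q visited]`, each visit at most once
      have hvis : ∀ q, (((List.range (b - a)).map fun i ↦ h (a + i)).map fun g ↦
          (Pi.single ((g⁻¹ : SL(2, ℤ)) : Gamma0Coset N) (1 : ℤ) - Pi.single (((g * S)⁻¹ : SL(2, ℤ)) : Gamma0Coset N) 1 :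
            Gamma0Coset N → ℤ)).sum q =
          (∑ i ∈ Finset.range (b - a), (if x (a + i) = q then (1 : ℤ) else 0)) -
          (∑ i ∈ Finset.range (b - a), (if x (a + i) = S • q then (1 : ℤ) else 0)) := by
        intro q
        rw [dualChainVec_apply, List.map_map, ← Finset.sum_sub_distrib, ← list_sum_map_range]
        congr 1
        refine List.map_congr_left fun i _ ↦ ?_
        have hSS : ∀ q : Gamma0Coset N, S • S • q = q := fun q ↦ by
          rw [← mul_smul, S_mul_S_eq_neg_one, neg_one_smul_coset]
        have e2 : ((((h (a + i) * S)⁻¹ : SL(2, ℤ)) : Gamma0Coset N) = q) ↔ (x (a + i) = S • q) := by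
          rw [coe_mul_S_inv, hc]
          constructor
          · intro e; rw [← e, hSS]
          · intro e; rw [e, hSS]
        simp only [Function.comp_apply, hc, e2]
      have hcount_le : ∀ q, (∑ i ∈ Finset.range (b - a), (if x (a + i) = q then (1 : ℤ) else 0)) ≤ 1 := by
        intro q
        by_cases hq : ∃ i ∈ Finset.range (b - a), x (a + i) = q
        · obtain ⟨i, hi, hiq⟩ := hq
          rw [Finset.sum_eq_single i]
          · simp [hiq]
          · intro i' hi' hne
            rw [if_neg]
            intro he
            apply hne
            have := hdist (a + i') (a + i) (by simp at hi'; omega) (by simp at hi; omega) (by rw [he, hiq])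
            omega
          · intro hi'; exact (hi' hi).elim
        · simp only [not_exists, not_and] at hq
          rw [Finset.sum_eq_zero fun i hi ↦ if_neg (hq i hi)]
          omega
      have hcount_nonneg : ∀ q, 0 ≤ (∑ i ∈ Finset.range (b - a), (if x (a + i) = q then (1 : ℤ) else 0)) :=
        fun q ↦ Finset.sum_nonneg fun i _ ↦ by split_ifs <;> omega
      have hcount_pos : ∀ q, 0 < (∑ i ∈ Finset.range (b - a), (if x (a + i) = q then (1 : ℤ) else 0)) → 0 < M q := by
        intro q hq
        obtain ⟨i, hi, hne⟩ := Finset.exists_ne_zero_of_sum_ne_zero hq.ne'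
        have hiq : x (a + i) = q := by by_contra hh; exact hne (if_neg hh)
        rw [← hiq]; exact hx_pos _
      -- the new system
      set v : Gamma0Coset N → ℤ := fun q ↦ (D₁.map fun g ↦ (Pi.single ((g⁻¹ : SL(2, ℤ)) : Gamma0Coset N) (1 : ℤ) -
          Pi.single (((g * S)⁻¹ : SL(2, ℤ)) : Gamma0Coset N) 1 : Gamma0Coset N → ℤ)).sum q with hv
      set M' : Gamma0Coset N → ℤ := fun q ↦ M q - v q with hM'
      have hM'1 : ∀ q, M' (S • q) = -M' q := fun q ↦ by
        simp only [hM', hv, hM1, dualChainVec_smul_S]; ring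
      have hM'2 : ∀ q, M' q + M' ((T * S) • q) + M' ((T * S) • (T * S) • q) = 0 := fun q ↦ by
        simp only [hM', hv]
        have := dualChainVec_three_term γ₁ D₁ hD₁ q
        have := hM2 q
        omega
      -- termwise decrease of `|M|`
      have hterm : ∀ q, (M' q).natAbs ≤ (M q).natAbs ∧
          (0 < (∑ i ∈ Finset.range (b - a), (if x (a + i) = q then (1 : ℤ) else 0)) → (M' q).natAbs < (M q).natAbs) := by
        intro q
        have e : v q = (∑ i ∈ Finset.range (b - a), (if x (a + i) = q then (1 : ℤ) else 0)) -
            (∑ i ∈ Finset.range (b - a), (if x (a + i) = S • q then (1 : ℤ) else 0)) := by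
          simp only [hv]; rw [hvec₁ q, hvis q]
        have h1 := hcount_le q
        have h2 := hcount_le (S • q)
        have h3 := hcount_nonneg q
        have h4 := hcount_nonneg (S • q)
        have h5 := hcount_pos q
        have h6 := hcount_pos (S • q)
        have h7 := hM1 q
        simp only [hM']
        rw [e]
        constructor <;> omega
      have hlt : (∑ q, (M' q).natAbs) < n := by
        rw [← hn]
        apply Finset.sum_lt_sum (fun q _ ↦ (hterm q).1)
        refine ⟨x a, Finset.mem_univ _, (hterm (x a)).2 ?_⟩
        have hba : 0 < b - a := Nat.sub_pos_of_lt hab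
        have : (if x (a + 0) = x a then (1 : ℤ) else 0) ≤
            ∑ i ∈ Finset.range (b - a), (if x (a + i) = x a then (1 : ℤ) else 0) :=
          Finset.single_le_sum (f := fun i ↦ (if x (a + i) = x a then (1 : ℤ) else 0))
            (fun i _ ↦ by split_ifs <;> omega) (Finset.mem_range.mpr hba)
        rw [add_zero, if_pos rfl] at this
        omega
      obtain ⟨γ₂, D₂, hD₂, hvec₂⟩ := ih _ hlt M' rfl hM'1 hM'2
      -- combine: `M = vec D₁ + vec D₂ = vec D` for a dual chain `D` of `γ₁ γ₂`
      obtain ⟨D, hD⟩ := exists_dualChain ((γ₁ * γ₂ : Gamma0 N) : SL(2, ℤ))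
      refine ⟨γ₁ * γ₂, D, hD, fun q ↦ ?_⟩
      rw [dualChainVec_mul γ₁ γ₂ D₁ D₂ D hD₁ hD₂ hD q, hvec₂ q]
      simp only [hM', hv]
      ring

end Flow

end Summit.BirchSwinnertonDyer.BirchSwinnertonDyer.Theorems.ThetaLayerLambdaCongruenceAtTwo

end
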